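import Mathlib
import Summits.ValiantsHypothesis.ValiantsHypothesis.Theorems.RigidityForcesSymmetryRankRigidMinimalReprLaplaceFiveCertified

/-!
# `LaplaceOptimalFive`, slice class `a = 3`: the «parallel pairs» exceptional types (three pair terms on one cut)
# (crux `RankRigidMinimalRepr`, stmt-ValiantsHypothesis-18034; frontier rung `LaplaceOptimalFive`, stmt-24813)

Two of the ten three-slice profile types without a kill-everything dual certificate (evidence note of seat
val-width-24813-w1 on stmt-24813) are refuted here by a POSITIVE-DIMENSIONAL dual argument («peeling» two slots):

`parallel_pairs_core` — the `5 × 5` permutation pattern is not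
`α₁(v₀) W₁ + α₂(v₀) W₂ + β(v₁) W₃ + γ(v₂) W₄ + Σ_{t<3} u_t(v₀,v₁) w_t(v₂,v₃,v₄)` (slices at slots `0, 0, 1, 2`, three pair
terms on the cut `{0,1}`; any of them may vanish).  Proof: pick `x ⊥ α₁, α₂` with three non-zero coordinates
(`exists_support_three`), then `y ≠ 0` with `y ⊥ β` killing the three bilinear forms `Σ x_a y_b u_t(a,b)` (four linear
conditions in `ℂ⁵`), then some symmetric product `m_{ab} = x_a y_b + x_b y_a` is non-zero (`eq_zero_of_sym_products`:
otherwise `y = 0`, using the three non-zero coordinates of `x` and `2 ≠ 0`), then `z ⊥ γ` with `z_a = z_b = 0`, `z ≠ 0`,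
so `z_c ≠ 0` for a third letter `c`; contracting the identity at slots `0, 1, 2` with `x, y, z` and fixing the last two
slots to the remaining letters `d, e` gives `z_c · m_{ab} = 0` — every slice is killed by orthogonality and blindness,
every pair term by the choice of `y`.

Consequences in the format of the hypotheses `hexB` / `hexC` of `three_slices_three_pairs_all`
(`…LaplaceFiveThreeSlicesAll.lean`): `three_slices_exc_B_010101` (slices `![0,0,1]`, cuts `(0,1)³` — type B4) and
`three_slices_exc_C_010101` (slices `![0,1,2]`, cuts `(0,1)³` — type C8); the relabelled variants `(0,2)³`, `(1,2)³` are
in `…LaplaceFiveParallelPairsRelabelled.lean`.  Together: 4 of the 27 exceptional sorted configurations (2 of the 10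
types) are discharged; 23 (8 types) remain.  No new definitions.  HONEST FRAMING: an exact partial result toward the
frontier rung `LaplaceOptimalFive` (stmt-24813), which stays OPEN; nothing here bears on `VP ≠ VNP`.
-/

set_option autoImplicit false

-- the mandated summit-side namespace repeats a component by design (single-problem summit)
set_option linter.dupNamespace false

namespace Summit.ValiantsHypothesis.ValiantsHypothesis.Theorems.RigidityForcesSymmetryRankRigidMinimalRepr

namespace LaplaceFiveSlices

open Finset

/-! ### §1 Small helpers -/

/-- Five distinct letters from three: the two remaining ones. -/
theorem five_rest : ∀ a b c : Fin 5, a ≠ b → a ≠ c → b ≠ c →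
    ∃ d e : Fin 5, d ≠ a ∧ d ≠ b ∧ d ≠ c ∧ e ≠ a ∧ e ≠ b ∧ e ≠ c ∧ d ≠ e := by
  decide

/-- A vector with pairwise distinct entries is injective. -/
theorem injective_vec5 (a b c d e : Fin 5) (hab : a ≠ b) (hac : a ≠ c) (had : a ≠ d) (hae : a ≠ e) (hbc : b ≠ c)
    (hbd : b ≠ d) (hbe : b ≠ e) (hcd : c ≠ d) (hce : c ≠ e) (hde : d ≠ e) :
    Function.Injective (![a, b, c, d, e] : Fin 5 → Fin 5) := by
  intro i j h
  fin_cases i <;> fin_cases j <;> simp at h <;>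
    first | rfl | exact absurd h ‹_› | exact absurd h.symm ‹_›

/-- A function taking the same value at two distinct arguments is not injective. -/
theorem not_injective_of_eq (f : Fin 5 → Fin 5) (i j : Fin 5) (hij : i ≠ j) (h : f i = f j) :
    ¬ Function.Injective f := fun hf => hij (hf h)

/-- **Three non-zero coordinates in the common kernel of two functionals on `ℂ⁵`.** -/
theorem exists_support_three (α₁ α₂ : Fin 5 → ℂ) : ∃ x : Fin 5 → ℂ,
    (∑ c, x c * α₁ c) = 0 ∧ (∑ c, x c * α₂ c) = 0 ∧
    ∃ a b c : Fin 5, a ≠ b ∧ a ≠ c ∧ b ≠ c ∧ x a ≠ 0 ∧ x b ≠ 0 ∧ x c ≠ 0 := by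
  classical
  -- a first solution and a non-zero coordinate `a`
  obtain ⟨z, hz0, hz⟩ := LaplaceTriangular.exists_ne_zero_orthogonal (n := 5) ({α₁, α₂} : Finset (Fin 5 → ℂ))
    (lt_of_le_of_lt Finset.card_le_two (by norm_num))
  obtain ⟨a, ha⟩ : ∃ a, z a ≠ 0 := by by_contra h; push Not at h; exact hz0 (funext h)
  -- a second solution vanishing at `a`, with a non-zero coordinate `b ≠ a`
  obtain ⟨z', hz'0, hz'⟩ := LaplaceTriangular.exists_ne_zero_orthogonal (n := 5)
    ({α₁, α₂, Pi.single a 1} : Finset (Fin 5 → ℂ)) (lt_of_le_of_lt Finset.card_le_three (by norm_num))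
  have hz'a : z' a = 0 := by simpa [Pi.single_apply] using hz' (Pi.single a 1) (by simp)
  obtain ⟨b, hb⟩ : ∃ b, z' b ≠ 0 := by by_contra h; push Not at h; exact hz'0 (funext h)
  have hba : b ≠ a := fun h => hb (h ▸ hz'a)
  -- a third solution vanishing at `a, b`, with a non-zero coordinate `c ∉ {a, b}`
  obtain ⟨z'', hz''0, hz''⟩ := LaplaceTriangular.exists_ne_zero_orthogonal (n := 5)
    ({α₁, α₂, Pi.single a 1, Pi.single b 1} : Finset (Fin 5 → ℂ)) (lt_of_le_of_lt Finset.card_le_four (by norm_num))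
  have hz''a : z'' a = 0 := by simpa [Pi.single_apply] using hz'' (Pi.single a 1) (by simp)
  have hz''b : z'' b = 0 := by simpa [Pi.single_apply] using hz'' (Pi.single b 1) (by simp)
  obtain ⟨c, hc⟩ : ∃ c, z'' c ≠ 0 := by by_contra h; push Not at h; exact hz''0 (funext h)
  have hca : c ≠ a := fun h => hc (h ▸ hz''a)
  have hcb : c ≠ b := fun h => hc (h ▸ hz''b)
  -- the combination
  set s : ℂ := (1 - z b) / z' b with hs
  set t : ℂ := (1 - z c - s * z' c) / z'' c with ht
  refine ⟨fun i => z i + s * z' i + t * z'' i, ?_, ?_, a, b, c, hba.symm, hca.symm, hcb.symm, ?_, ?_, ?_⟩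
  · have e1 := hz α₁ (by simp); have e2 := hz' α₁ (by simp); have e3 := hz'' α₁ (by simp)
    have : ∑ i, (z i + s * z' i + t * z'' i) * α₁ i =
        (∑ i, z i * α₁ i) + s * (∑ i, z' i * α₁ i) + t * (∑ i, z'' i * α₁ i) := by
      simp only [add_mul, sum_add_distrib, mul_sum, mul_assoc]
    rw [this, e1, e2, e3]; ring
  · have e1 := hz α₂ (by simp); have e2 := hz' α₂ (by simp); have e3 := hz'' α₂ (by simp)
    have : ∑ i, (z i + s * z' i + t * z'' i) * α₂ i =
        (∑ i, z i * α₂ i) + s * (∑ i, z' i * α₂ i) + t * (∑ i, z'' i * α₂ i) := by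
      simp only [add_mul, sum_add_distrib, mul_sum, mul_assoc]
    rw [this, e1, e2, e3]; ring
  · show z a + s * z' a + t * z'' a ≠ 0
    rw [hz'a, hz''a]; simpa using ha
  · show z b + s * z' b + t * z'' b ≠ 0
    have : z b + s * z' b + t * z'' b = 1 := by
      rw [hz''b, hs]; field_simp; ring
    rw [this]; exact one_ne_zero
  · show z c + s * z' c + t * z'' c ≠ 0
    have : z c + s * z' c + t * z'' c = 1 := by
      rw [ht]; field_simp; ring
    rw [this]; exact one_ne_zero

/-- **Injectivity of the symmetric products.**  If `x` has three non-zero coordinates and all symmetric products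
`x_i y_j + x_j y_i` (`i ≠ j`) vanish, then `y = 0` (uses `2 ≠ 0` in `ℂ`). -/
theorem eq_zero_of_sym_products (x y : Fin 5 → ℂ) (a b c : Fin 5) (hab : a ≠ b) (hac : a ≠ c) (hbc : b ≠ c)
    (ha : x a ≠ 0) (hb : x b ≠ 0) (hc : x c ≠ 0) (h : ∀ i j, i ≠ j → x i * y j + x j * y i = 0) : y = 0 := by
  have e1 := h a b hab
  have e2 := h a c hac
  have e3 := h b c hbc
  have hya : y a = 0 := by
    have h2 : (2 : ℂ) * (x b * x c) * y a = 0 := by linear_combination x c * e1 + x b * e2 - x a * e3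
    rcases mul_eq_zero.mp h2 with h2 | h2
    · rcases mul_eq_zero.mp h2 with h2 | h2
      · norm_num at h2
      · rcases mul_eq_zero.mp h2 with h2 | h2
        · exact absurd h2 hb
        · exact absurd h2 hc
    · exact h2
  funext j
  by_cases hj : j = a
  · rw [hj, hya]; rfl
  · have e := h a j (fun h' => hj h'.symm)
    rw [hya, mul_zero, add_zero] at e
    rcases mul_eq_zero.mp e with e | e
    · exact absurd e ha
    · exact e

/-! ### §2 The core: slices at slots `0, 0, 1, 2`, three pair terms on the cut `{0, 1}` -/

/-- **Parallel pairs.**  The `5 × 5` permutation pattern is not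
`α₁(v₀) W₁(v) + α₂(v₀) W₂(v) + β(v₁) W₃(v) + γ(v₂) W₄(v) + Σ_{t<3} u_t(v) w_t(v)` with `W₁, W₂` blind to slot `0`, `W₃`
blind to slot `1`, `W₄` blind to slot `2`, `u_t` depending on the slots `0, 1` only and `w_t` blind to them. -/
theorem parallel_pairs_core (α₁ α₂ β γ : Fin 5 → ℂ) (W₁ W₂ W₃ W₄ : (Fin 5 → Fin 5) → ℂ)
    (hW₁ : ∀ v v' : Fin 5 → Fin 5, (∀ j, j ≠ 0 → v j = v' j) → W₁ v = W₁ v')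
    (hW₂ : ∀ v v' : Fin 5 → Fin 5, (∀ j, j ≠ 0 → v j = v' j) → W₂ v = W₂ v')
    (hW₃ : ∀ v v' : Fin 5 → Fin 5, (∀ j, j ≠ 1 → v j = v' j) → W₃ v = W₃ v')
    (hW₄ : ∀ v v' : Fin 5 → Fin 5, (∀ j, j ≠ 2 → v j = v' j) → W₄ v = W₄ v')
    (u w : Fin 3 → (Fin 5 → Fin 5) → ℂ)
    (hu : ∀ t, ∀ v v' : Fin 5 → Fin 5, v 0 = v' 0 → v 1 = v' 1 → u t v = u t v')
    (hw : ∀ t, ∀ v v' : Fin 5 → Fin 5, (∀ j, j ≠ 0 → j ≠ 1 → v j = v' j) → w t v = w t v') :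
    ¬ ∀ v : Fin 5 → Fin 5, (if Function.Injective v then (1 : ℂ) else 0) =
        α₁ (v 0) * W₁ v + α₂ (v 0) * W₂ v + β (v 1) * W₃ v + γ (v 2) * W₄ v + ∑ t, u t v * w t v := by
  classical
  intro H
  -- STEP 1: `x ⊥ α₁, α₂` with three non-zero coordinates
  obtain ⟨x, hx1, hx2, a, b, c, hab, hac, hbc, hxa, hxb, hxc⟩ := exists_support_three α₁ α₂
  -- STEP 2: `y ≠ 0` with `y ⊥ β` killing the three bilinear forms
  let n : Fin 3 → Fin 5 → ℂ := fun t b' => ∑ a', x a' * u t ![a', b', 0, 0, 0]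
  obtain ⟨y, hy0, hy⟩ := LaplaceTriangular.exists_ne_zero_orthogonal (n := 5)
    ({β, n 0, n 1, n 2} : Finset (Fin 5 → ℂ)) (lt_of_le_of_lt Finset.card_le_four (by norm_num))
  have hyβ : ∑ i, y i * β i = 0 := hy β (by simp)
  have hlam : ∀ t, ∑ v0, ∑ v1, x v0 * y v1 * u t ![v0, v1, 0, 0, 0] = 0 := by
    intro t
    have hnt : ∑ i, y i * n t i = 0 := by
      fin_cases t
      · exact hy (n 0) (by simp)
      · exact hy (n 1) (by simp)
      · exact hy (n 2) (by simp)
    rw [Finset.sum_comm]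
    rw [← hnt]
    refine sum_congr rfl fun v1 _ => ?_
    simp only [n, mul_sum]
    refine sum_congr rfl fun v0 _ => ?_
    ring
  -- STEP 3: a non-zero symmetric product `m = x a0 y b0 + x b0 y a0`
  obtain ⟨a0, b0, hab0, hm⟩ : ∃ a0 b0 : Fin 5, a0 ≠ b0 ∧ x a0 * y b0 + x b0 * y a0 ≠ 0 := by
    by_contra hall
    push Not at hall
    exact hy0 (eq_zero_of_sym_products x y a b c hab hac hbc hxa hxb hxc hall)
  -- STEP 4: `z ⊥ γ` with `z a0 = z b0 = 0`, `z c0 ≠ 0`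
  obtain ⟨z, hz0, hz⟩ := LaplaceTriangular.exists_ne_zero_orthogonal (n := 5)
    ({γ, Pi.single a0 1, Pi.single b0 1} : Finset (Fin 5 → ℂ)) (lt_of_le_of_lt Finset.card_le_three (by norm_num))
  have hzγ : ∑ i, z i * γ i = 0 := hz γ (by simp)
  have hza : z a0 = 0 := by simpa [Pi.single_apply] using hz (Pi.single a0 1) (by simp)
  have hzb : z b0 = 0 := by simpa [Pi.single_apply] using hz (Pi.single b0 1) (by simp)
  obtain ⟨c0, hc0⟩ : ∃ c0, z c0 ≠ 0 := by by_contra h; push Not at h; exact hz0 (funext h)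
  have hc0a : c0 ≠ a0 := fun h => hc0 (h ▸ hza)
  have hc0b : c0 ≠ b0 := fun h => hc0 (h ▸ hzb)
  obtain ⟨d, e, hda, hdb, hdc, hea, heb, hec, hde⟩ := five_rest a0 b0 c0 hab0 hc0a.symm hc0b.symm
  -- every letter is one of `a0, b0, c0, d, e`
  have hexh : ∀ j : Fin 5, j = a0 ∨ j = b0 ∨ j = c0 ∨ j = d ∨ j = e := fun j =>
    mem_of_five_distinct a0 b0 c0 d e j hab0 hc0a.symm hda.symm hea.symm hc0b.symm hdb.symm heb.symm hdc.symm hec.symm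
      hde
  -- STEP 5: contract the identity at slots `0, 1, 2` with `x, y, z`, the last two slots fixed to `d, e`
  let V : Fin 5 → Fin 5 → Fin 5 → (Fin 5 → Fin 5) := fun v0 v1 v2 => ![v0, v1, v2, d, e]
  have hV0 : ∀ v0 v1 v2, V v0 v1 v2 0 = v0 := fun _ _ _ => rfl
  have hV1 : ∀ v0 v1 v2, V v0 v1 v2 1 = v1 := fun _ _ _ => rfl
  have hV2 : ∀ v0 v1 v2, V v0 v1 v2 2 = v2 := fun _ _ _ => rfl
  have hV3 : ∀ v0 v1 v2, V v0 v1 v2 3 = d := fun _ _ _ => rfl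
  have hV4 : ∀ v0 v1 v2, V v0 v1 v2 4 = e := fun _ _ _ => rfl
  have key : ∑ v2, ∑ v0, ∑ v1, x v0 * y v1 * z v2 *
        (if Function.Injective (V v0 v1 v2) then (1 : ℂ) else 0) =
      ∑ v2, ∑ v0, ∑ v1, x v0 * y v1 * z v2 *
        (α₁ v0 * W₁ (V v0 v1 v2) + α₂ v0 * W₂ (V v0 v1 v2) + β v1 * W₃ (V v0 v1 v2) + γ v2 * W₄ (V v0 v1 v2) +
          ∑ t, u t (V v0 v1 v2) * w t (V v0 v1 v2)) := by
    refine sum_congr rfl fun v2 _ => sum_congr rfl fun v0 _ => sum_congr rfl fun v1 _ => ?_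
    have Hv := H (V v0 v1 v2)
    rw [hV0, hV1, hV2] at Hv
    rw [Hv]
  -- STEP 6: the left-hand side is `z c0 · m`
  have hnotinj : ∀ v0 v1 v2, ∀ i j : Fin 5, i ≠ j → V v0 v1 v2 i = V v0 v1 v2 j →
      (if Function.Injective (V v0 v1 v2) then (1 : ℂ) else 0) = 0 := by
    intro v0 v1 v2 i j hij h
    rw [if_neg (not_injective_of_eq _ i j hij h)]
  have lhs : ∑ v2, ∑ v0, ∑ v1, x v0 * y v1 * z v2 *
        (if Function.Injective (V v0 v1 v2) then (1 : ℂ) else 0) = z c0 * (x a0 * y b0 + x b0 * y a0) := by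
    rw [Fintype.sum_eq_single c0]
    · -- the `v2 = c0` layer: only `(v0, v1) ∈ {(a0, b0), (b0, a0)}` survive
      rw [Fintype.sum_eq_add a0 b0 hab0]
      · rw [Fintype.sum_eq_single b0, Fintype.sum_eq_single a0]
        · rw [if_pos (injective_vec5 a0 b0 c0 d e hab0 hc0a.symm hda.symm hea.symm hc0b.symm hdb.symm heb.symm
            hdc.symm hec.symm hde),
            if_pos (injective_vec5 b0 a0 c0 d e hab0.symm hc0b.symm hdb.symm heb.symm hc0a.symm hda.symm hea.symm
            hdc.symm hec.symm hde)]
          ring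
        · intro v1 hv1
          rcases hexh v1 with rfl | rfl | rfl | rfl | rfl
          · exact absurd rfl hv1
          · rw [hnotinj _ _ _ 0 1 (by decide) (by rw [hV0, hV1])]; ring
          · rw [hnotinj _ _ _ 1 2 (by decide) (by rw [hV1, hV2])]; ring
          · rw [hnotinj _ _ _ 1 3 (by decide) (by rw [hV1, hV3])]; ring
          · rw [hnotinj _ _ _ 1 4 (by decide) (by rw [hV1, hV4])]; ring
        · intro v1 hv1
          rcases hexh v1 with rfl | rfl | rfl | rfl | rfl
          · rw [hnotinj _ _ _ 0 1 (by decide) (by rw [hV0, hV1])]; ring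
          · exact absurd rfl hv1
          · rw [hnotinj _ _ _ 1 2 (by decide) (by rw [hV1, hV2])]; ring
          · rw [hnotinj _ _ _ 1 3 (by decide) (by rw [hV1, hV3])]; ring
          · rw [hnotinj _ _ _ 1 4 (by decide) (by rw [hV1, hV4])]; ring
      · -- `v0 ∉ {a0, b0}`: every term has a repeated letter
        intro v0 hv0
        refine sum_eq_zero fun v1 _ => ?_
        rcases hexh v0 with rfl | rfl | rfl | rfl | rfl
        · exact absurd rfl hv0.1
        · exact absurd rfl hv0.2
        · rw [hnotinj _ _ _ 0 2 (by decide) (by rw [hV0, hV2])]; ring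
        · rw [hnotinj _ _ _ 0 3 (by decide) (by rw [hV0, hV3])]; ring
        · rw [hnotinj _ _ _ 0 4 (by decide) (by rw [hV0, hV4])]; ring
    · -- `v2 ≠ c0`: `z v2 = 0` or a repeated letter
      intro v2 hv2
      refine sum_eq_zero fun v0 _ => sum_eq_zero fun v1 _ => ?_
      rcases hexh v2 with rfl | rfl | rfl | rfl | rfl
      · rw [hza]; ring
      · rw [hzb]; ring
      · exact absurd rfl hv2
      · rw [hnotinj _ _ _ 2 3 (by decide) (by rw [hV2, hV3])]; ring
      · rw [hnotinj _ _ _ 2 4 (by decide) (by rw [hV2, hV4])]; ring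
  -- STEP 7: the right-hand side vanishes
  -- blindness rewrites
  have hW₁' : ∀ v0 v1 v2, W₁ (V v0 v1 v2) = W₁ (V 0 v1 v2) := fun v0 v1 v2 =>
    hW₁ _ _ (fun j hj => by fin_cases j <;> first | exact absurd rfl hj | rfl)
  have hW₂' : ∀ v0 v1 v2, W₂ (V v0 v1 v2) = W₂ (V 0 v1 v2) := fun v0 v1 v2 =>
    hW₂ _ _ (fun j hj => by fin_cases j <;> first | exact absurd rfl hj | rfl)
  have hW₃' : ∀ v0 v1 v2, W₃ (V v0 v1 v2) = W₃ (V v0 0 v2) := fun v0 v1 v2 =>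
    hW₃ _ _ (fun j hj => by fin_cases j <;> first | exact absurd rfl hj | rfl)
  have hW₄' : ∀ v0 v1 v2, W₄ (V v0 v1 v2) = W₄ (V v0 v1 0) := fun v0 v1 v2 =>
    hW₄ _ _ (fun j hj => by fin_cases j <;> first | exact absurd rfl hj | rfl)
  have hu' : ∀ t v0 v1 v2, u t (V v0 v1 v2) = u t ![v0, v1, 0, 0, 0] := fun t v0 v1 v2 =>
    hu t _ _ (by rw [hV0]; rfl) (by rw [hV1]; rfl)
  have hw' : ∀ t v0 v1 v2, w t (V v0 v1 v2) = w t (V 0 0 v2) := fun t v0 v1 v2 =>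
    hw t _ _ (fun j hj0 hj1 => by fin_cases j <;> first | exact absurd rfl hj0 | exact absurd rfl hj1 | rfl)
  have rhs : ∑ v2, ∑ v0, ∑ v1, x v0 * y v1 * z v2 *
        (α₁ v0 * W₁ (V v0 v1 v2) + α₂ v0 * W₂ (V v0 v1 v2) + β v1 * W₃ (V v0 v1 v2) + γ v2 * W₄ (V v0 v1 v2) +
          ∑ t, u t (V v0 v1 v2) * w t (V v0 v1 v2)) = 0 := by
    -- split into the five families of terms
    have split : ∀ v0 v1 v2, x v0 * y v1 * z v2 *
        (α₁ v0 * W₁ (V v0 v1 v2) + α₂ v0 * W₂ (V v0 v1 v2) + β v1 * W₃ (V v0 v1 v2) + γ v2 * W₄ (V v0 v1 v2) +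
          ∑ t, u t (V v0 v1 v2) * w t (V v0 v1 v2)) =
        (x v0 * α₁ v0) * (y v1 * z v2 * W₁ (V 0 v1 v2)) + (x v0 * α₂ v0) * (y v1 * z v2 * W₂ (V 0 v1 v2)) +
        (y v1 * β v1) * (x v0 * z v2 * W₃ (V v0 0 v2)) + (z v2 * γ v2) * (x v0 * y v1 * W₄ (V v0 v1 0)) +
        ∑ t, (z v2 * w t (V 0 0 v2)) * (x v0 * y v1 * u t ![v0, v1, 0, 0, 0]) := by
      intro v0 v1 v2
      rw [hW₁', hW₂', hW₃', hW₄']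
      simp only [hu', hw', mul_add, mul_sum]
      congr 1
      · ring
      · exact sum_congr rfl fun t _ => by ring
    simp only [split, sum_add_distrib]
    -- family 1 and 2: `Σ_{v0} x v0 α v0 = 0`
    have f1 : ∀ (αs : Fin 5 → ℂ) (G : Fin 5 → Fin 5 → ℂ), (∑ i, x i * αs i) = 0 →
        ∑ v2, ∑ v0, ∑ v1, (x v0 * αs v0) * G v1 v2 = 0 := by
      intro αs G h0
      refine sum_eq_zero fun v2 _ => ?_
      rw [Finset.sum_comm]
      refine sum_eq_zero fun v1 _ => ?_
      rw [← sum_mul, h0, zero_mul]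
    -- family 3: `Σ_{v1} y v1 β v1 = 0`
    have f3 : ∀ (G : Fin 5 → Fin 5 → ℂ), ∑ v2, ∑ v0, ∑ v1, (y v1 * β v1) * G v0 v2 = 0 := by
      intro G
      refine sum_eq_zero fun v2 _ => sum_eq_zero fun v0 _ => ?_
      rw [← sum_mul, hyβ, zero_mul]
    -- family 4: `Σ_{v2} z v2 γ v2 = 0`
    have f4 : ∀ (G : Fin 5 → Fin 5 → ℂ), ∑ v2, ∑ v0, ∑ v1, (z v2 * γ v2) * G v0 v1 = 0 := by
      intro G
      have : ∀ v2, ∑ v0, ∑ v1, (z v2 * γ v2) * G v0 v1 = (z v2 * γ v2) * ∑ v0, ∑ v1, G v0 v1 := by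
        intro v2; rw [mul_sum]; exact sum_congr rfl fun v0 _ => by rw [mul_sum]
      simp only [this]
      rw [← sum_mul, hzγ, zero_mul]
    -- family 5: the pair terms, `λ_t = 0`
    have f5 : ∑ v2, ∑ v0, ∑ v1, ∑ t, (z v2 * w t (V 0 0 v2)) * (x v0 * y v1 * u t ![v0, v1, 0, 0, 0]) = 0 := by
      refine sum_eq_zero fun v2 _ => ?_
      have step1 : ∑ v0, ∑ v1, ∑ t, (z v2 * w t (V 0 0 v2)) * (x v0 * y v1 * u t ![v0, v1, 0, 0, 0]) =
          ∑ v0, ∑ t, ∑ v1, (z v2 * w t (V 0 0 v2)) * (x v0 * y v1 * u t ![v0, v1, 0, 0, 0]) :=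
        sum_congr rfl (fun v0 _ => Finset.sum_comm)
      rw [step1, Finset.sum_comm]
      refine sum_eq_zero fun t _ => ?_
      have : ∑ v0, ∑ v1, (z v2 * w t (V 0 0 v2)) * (x v0 * y v1 * u t ![v0, v1, 0, 0, 0]) =
          (z v2 * w t (V 0 0 v2)) * ∑ v0, ∑ v1, x v0 * y v1 * u t ![v0, v1, 0, 0, 0] := by
        rw [mul_sum]; exact sum_congr rfl fun v0 _ => by rw [mul_sum]
      rw [this, hlam t, mul_zero]
    rw [f1 α₁ (fun v1 v2 => y v1 * z v2 * W₁ (V 0 v1 v2)) hx1,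
      f1 α₂ (fun v1 v2 => y v1 * z v2 * W₂ (V 0 v1 v2)) hx2,
      f3 (fun v0 v2 => x v0 * z v2 * W₃ (V v0 0 v2)), f4 (fun v0 v1 => x v0 * y v1 * W₄ (V v0 v1 0)), f5]
    ring
  -- STEP 8: contradiction
  have hfinal : z c0 * (x a0 * y b0 + x b0 * y a0) = 0 := by rw [← lhs, key, rhs]
  rcases mul_eq_zero.mp hfinal with h | h
  · exact hc0 h
  · exact hm h

/-! ### §3 The four exceptional sorted configurations of types B4 and C8 -/

/-- **Type B4** (slices `![0,0,1]`, cuts `(0,1), (0,1), (0,1)`), in the format of the hypothesis `hexB` of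
`three_slices_three_pairs_all` at `(p0,q0,p1,q1,p2,q2) = (0,1,0,1,0,1)`. -/
theorem three_slices_exc_B_010101 :
    ∀ (α : Fin 3 → Fin 5 → ℂ) (W : Fin 3 → (Fin 5 → Fin 5) → ℂ),
      (∀ k, ∀ v v' : Fin 5 → Fin 5, (∀ j, j ≠ (![0, 0, 1] : Fin 3 → Fin 5) k → v j = v' j) → W k v = W k v') →
      ∀ (u w : Fin 3 → (Fin 5 → Fin 5) → ℂ),
      (∀ t, ∀ v v' : Fin 5 → Fin 5,
          v ((![0, 0, 0] : Fin 3 → Fin 5) t) = v' ((![0, 0, 0] : Fin 3 → Fin 5) t) →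
          v ((![1, 1, 1] : Fin 3 → Fin 5) t) = v' ((![1, 1, 1] : Fin 3 → Fin 5) t) → u t v = u t v') →
      (∀ t, ∀ v v' : Fin 5 → Fin 5,
          (∀ j, j ≠ (![0, 0, 0] : Fin 3 → Fin 5) t → j ≠ (![1, 1, 1] : Fin 3 → Fin 5) t → v j = v' j) →
          w t v = w t v') →
      ¬ ∀ v : Fin 5 → Fin 5, (if Function.Injective v then (1 : ℂ) else 0) =
          (∑ k, α k (v ((![0, 0, 1] : Fin 3 → Fin 5) k)) * W k v) + ∑ t, u t v * w t v := by
  intro α W hW u w hu hw H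
  refine parallel_pairs_core (α 0) (α 1) (α 2) 0 (W 0) (W 1) (W 2) (fun _ => 0) (hW 0) (hW 1) (hW 2)
    (fun _ _ _ => rfl) u w (fun t v v' h0 h1 => hu t v v' ?_ ?_) (fun t v v' h => hw t v v' ?_) (fun v => ?_)
  · fin_cases t <;> exact h0
  · fin_cases t <;> exact h1
  · intro j hj0 hj1; fin_cases t <;> exact h j hj0 hj1
  · rw [H v, Fin.sum_univ_three]
    simp only [Matrix.cons_val_zero, Matrix.cons_val_one, Matrix.head_cons, Matrix.cons_val_two, Matrix.tail_cons]
    ring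

/-- **Type C8** (slices `![0,1,2]`, cuts `(0,1), (0,1), (0,1)`), format of `hexC` at `(0,1,0,1,0,1)`. -/
theorem three_slices_exc_C_010101 :
    ∀ (α : Fin 3 → Fin 5 → ℂ) (W : Fin 3 → (Fin 5 → Fin 5) → ℂ),
      (∀ k, ∀ v v' : Fin 5 → Fin 5, (∀ j, j ≠ (![0, 1, 2] : Fin 3 → Fin 5) k → v j = v' j) → W k v = W k v') →
      ∀ (u w : Fin 3 → (Fin 5 → Fin 5) → ℂ),
      (∀ t, ∀ v v' : Fin 5 → Fin 5,
          v ((![0, 0, 0] : Fin 3 → Fin 5) t) = v' ((![0, 0, 0] : Fin 3 → Fin 5) t) →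
          v ((![1, 1, 1] : Fin 3 → Fin 5) t) = v' ((![1, 1, 1] : Fin 3 → Fin 5) t) → u t v = u t v') →
      (∀ t, ∀ v v' : Fin 5 → Fin 5,
          (∀ j, j ≠ (![0, 0, 0] : Fin 3 → Fin 5) t → j ≠ (![1, 1, 1] : Fin 3 → Fin 5) t → v j = v' j) →
          w t v = w t v') →
      ¬ ∀ v : Fin 5 → Fin 5, (if Function.Injective v then (1 : ℂ) else 0) =
          (∑ k, α k (v ((![0, 1, 2] : Fin 3 → Fin 5) k)) * W k v) + ∑ t, u t v * w t v := by
  intro α W hW u w hu hw H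
  refine parallel_pairs_core (α 0) 0 (α 1) (α 2) (W 0) (fun _ => 0) (W 1) (W 2) (hW 0) (fun _ _ _ => rfl) (hW 1)
    (hW 2) u w (fun t v v' h0 h1 => hu t v v' ?_ ?_) (fun t v v' h => hw t v v' ?_) (fun v => ?_)
  · fin_cases t <;> exact h0
  · fin_cases t <;> exact h1
  · intro j hj0 hj1; fin_cases t <;> exact h j hj0 hj1
  · rw [H v, Fin.sum_univ_three]
    simp only [Matrix.cons_val_zero, Matrix.cons_val_one, Matrix.head_cons, Matrix.cons_val_two, Matrix.tail_cons]
    ring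

end LaplaceFiveSlices

end Summit.ValiantsHypothesis.ValiantsHypothesis.Theorems.RigidityForcesSymmetryRankRigidMinimalRepr
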